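import Literature.Probability.Percolation.TwoClusterConditionalAssociationProofs
import Literature.Probability.Percolation.BondTriangularThetaComparison
import HarnessLib

/-!
# A sandwich extension of the van den Berg–Häggström–Kahn inequality — I: Lemma U and the
# restriction lemmas

Crux `PercNearOneGluing.AdditiveGluing` (stmt-CriticalPhenomena-4576), line
`subuniform-dead-pocket-maximum`, stub `stub_goodStep` (siege seat k41, kernel C1); lands with
`--supports stmt-CriticalPhenomena-4576`.  No new definitions, no named facts.  Part II
(`…SandwichBHK.lean`) proves Theorem S (the sandwich form of BHK 2006 Thm 1.1) and Corollary H.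

Setting: Bernoulli bond percolation with arbitrary edge probabilities on a finite vertex type `V`
(`prodBernoulli w` on `Set (Sym2 V)`), `C_v = openEdgeCluster ω v` (BHK's edge cluster),
`R_X = {s ↮ X}`; the finite-sum language of `Literature…ConditionalPositiveAssociationProofs`
(`BHK2006.weight`, `BHK2006.rC U v ω` = the cluster of `v` using the pairs inside `U` only,
`BHK2006.rD U v X` = `{v ↮ X}` inside `U`, `BHK2006.rS`, `BHK2006.blockFubini`).
Fix a source `s` and an observer `o`.  For a vertex set `T` and `h : Set (Sym2 V) → [0,1]` the
**sandwich function** (always written out in full) is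
  `g^(T)(ω) = 1{s ↔ o} + 1{s ↮ o} · h(C_o) · 1{o ↮ T}`
(inside `U`: `if (openGraph (ω ∩ edgesIn U)).Reachable s o then 1 else h (rC U o ω) * ind (rD U o T) ω`).

* `lemmaU` (unconditional): for `F` increasing and `h ≤ 1`, `E[F(C_s)] E[g^(∅)] ≤ E[F(C_s) g^(∅)]` —
  given `C_o = W` with `s ↮ o`, `C_s` is the cluster of `s` in the model with `W̄` deleted, so its
  `F`-mean is at most `E[F(C_s)]` (BHK's coupling, `BHK2006.sum_cond_cluster`);
  `lemmaU_restrict`: the same inside `U` (marginalisation `sum_weight_inter`).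
* `sand_restrict`: BHK's identity (6) for the observer's cluster — on `{s ↮ S in G[U∖Z]}`, the
  sandwich function `g^(W)` of `G[U]` (`W ⊇ Z`) is `g^((W∖Z) ∪ S)` of `G[U∖Z]`;
  `step_sum_gen`: the summed form of (6) for a general integrand (block Fubini).
-/

noncomputable section

open MeasureTheory unitInterval
open Literature.Probability.LatticeModels (prodBernoulli)
open Literature.Probability.Percolation
open Literature.Probability.Percolation.BHK2006

namespace Summit.CriticalPhenomena.PercolationContinuityZ3.Theorems

namespace SandwichK41

open scoped Classical
open DecisionTree (ind ind_of_mem ind_of_not_mem ind_nonneg)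

variable {V : Type*} [Fintype V]

/-! ### Lemma U -/

/-- **Lemma U (unconditional sandwich correlation).** For `F` increasing and `h ≤ 1`,
`E[F(C_s)] · E[g₀] ≤ E[F(C_s) g₀]` with `g₀ = 1{s ↔ o} + 1{s ↮ o} h(C_o)`: conditionally on
`C_o = W` with `s ↮ o`, `C_s` is the cluster of `s` in the model with `W̄` deleted (BHK 2006 p. 8),
whose `F`-mean is at most `E[F(C_s)]`. [folklore; cite: VandenbergHaggstromKahn2005, §1 p. 8 (coupling)] -/
theorem lemmaU (w : Sym2 V → ℝ) (hw0 : ∀ e, 0 ≤ w e) (hw1 : ∀ e, w e ≤ 1)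
    (hm : ∑ ω, weight w ω = 1) (s o : V) (F : Set (Sym2 V) → ℝ) (hF : Monotone F)
    (h : Set (Sym2 V) → ℝ) (h1 : ∀ C, h C ≤ 1) :
    (∑ ω, weight w ω * F (openEdgeCluster ω s)) *
        (∑ ω, weight w ω *
          (if (openGraph ω).Reachable s o then (1 : ℝ) else h (openEdgeCluster ω o))) ≤
      ∑ ω, weight w ω * (F (openEdgeCluster ω s) *
          (if (openGraph ω).Reachable s o then (1 : ℝ) else h (openEdgeCluster ω o))) := by
  set g : Set (Sym2 V) → ℝ := fun ω =>
    if (openGraph ω).Reachable s o then (1 : ℝ) else h (openEdgeCluster ω o) with hg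
  show (∑ ω, weight w ω * F (openEdgeCluster ω s)) * (∑ ω, weight w ω * g ω) ≤
      ∑ ω, weight w ω * (F (openEdgeCluster ω s) * g ω)
  set D : Set (Set (Sym2 V)) := {ω | ¬ (openGraph ω).Reachable o s} with hD
  have hDiff : ∀ ω, ω ∈ D ↔ ¬ (openGraph ω).Reachable o s := fun ω => Iff.rfl
  set EF := ∑ ω, weight w ω * F (openEdgeCluster ω s) with hEF
  -- `g = 1 - k` with `k = (1 - h(C_o)) 1_D`
  set k : Set (Sym2 V) → ℝ := fun ω => (1 - h (openEdgeCluster ω o)) * ind D ω with hk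
  have hgk : ∀ ω, g ω = 1 - k ω := by
    intro ω
    simp only [hk, hg]
    by_cases hr : (openGraph ω).Reachable s o
    · rw [if_pos hr, ind_of_not_mem (show ω ∉ D from fun hω => hω hr.symm)]; ring
    · rw [if_neg hr, ind_of_mem (show ω ∈ D from fun hω => hr hω.symm)]; ring
  -- conditioning on `C_o`
  have hcond := sum_cond_cluster w hm o s (fun Co Cs => (1 - h Co) * F Cs) hDiff
  -- the conditional mean of `F(C_s)` given `C_o = W` is at most `EF`
  have hle : ∀ ω, (∑ η, weight w η * ((1 - h (openEdgeCluster ω o)) * F (openEdgeCluster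
      (η \ {e | ∃ v ∈ e, v = o ∨ ∃ e' ∈ openEdgeCluster ω o, v ∈ e'}) s))) * ind D ω ≤
      (1 - h (openEdgeCluster ω o)) * EF * ind D ω := by
    intro ω
    refine mul_le_mul_of_nonneg_right ?_ (ind_nonneg _ _)
    have : ∑ η, weight w η * ((1 - h (openEdgeCluster ω o)) * F (openEdgeCluster
        (η \ {e | ∃ v ∈ e, v = o ∨ ∃ e' ∈ openEdgeCluster ω o, v ∈ e'}) s)) =
        (1 - h (openEdgeCluster ω o)) * ∑ η, weight w η * F (openEdgeCluster
          (η \ {e | ∃ v ∈ e, v = o ∨ ∃ e' ∈ openEdgeCluster ω o, v ∈ e'}) s) := by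
      rw [Finset.mul_sum]
      exact Finset.sum_congr rfl fun η _ => by ring
    rw [this]
    refine mul_le_mul_of_nonneg_left ?_ (sub_nonneg.2 (h1 _))
    exact Finset.sum_le_sum fun η _ => mul_le_mul_of_nonneg_left
      (hF (openEdgeCluster_mono Set.sdiff_subset s)) (weight_nonneg hw0 hw1 η)
  have hFk : ∑ ω, weight w ω * (F (openEdgeCluster ω s) * k ω) ≤ EF * ∑ ω, weight w ω * k ω := by
    have e1 : ∑ ω, weight w ω * (F (openEdgeCluster ω s) * k ω) =
        ∑ ω, weight w ω * ((1 - h (openEdgeCluster ω o)) * F (openEdgeCluster ω s) * ind D ω) :=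
      Finset.sum_congr rfl fun ω _ => by simp only [hk]; ring
    have e2 : EF * ∑ ω, weight w ω * k ω =
        ∑ ω, weight w ω * ((1 - h (openEdgeCluster ω o)) * EF * ind D ω) := by
      rw [Finset.mul_sum]
      exact Finset.sum_congr rfl fun ω _ => by simp only [hk]; ring
    rw [e1, hcond, e2]
    exact Finset.sum_le_sum fun ω _ => mul_le_mul_of_nonneg_left (hle ω) (weight_nonneg hw0 hw1 ω)
  -- assemble
  have e3 : ∑ ω, weight w ω * g ω = 1 - ∑ ω, weight w ω * k ω := by
    have := sum_affine w g (fun _ => 1) k k k 1 (-1) 0 0 (fun ω => by rw [hgk]; ring)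
    rw [this]; simp [hm]; ring
  have e4 : ∑ ω, weight w ω * (F (openEdgeCluster ω s) * g ω) =
      EF - ∑ ω, weight w ω * (F (openEdgeCluster ω s) * k ω) := by
    have := sum_affine w (fun ω => F (openEdgeCluster ω s) * g ω)
      (fun ω => F (openEdgeCluster ω s)) (fun ω => F (openEdgeCluster ω s) * k ω) k k 1 (-1) 0 0
      (fun ω => by rw [hgk]; ring)
    rw [this]; simp [hEF]; ring
  rw [e3, e4]
  nlinarith [hFk]

/-! ### Marginalisation onto the pairs inside `U`, and Lemma U for the model restricted to `U` -/

/-- **Marginalisation**: integrating a function of `ω ∩ A` against the product weight is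
integrating it against the product weight with the parameters switched off outside `A`.
[folklore] -/
theorem sum_weight_inter {ι : Type*} [Fintype ι] (w : ι → ℝ) (hw0 : ∀ e, 0 ≤ w e)
    (hw1 : ∀ e, w e ≤ 1) (A : Set ι) (Ψ : Set ι → ℝ) :
    ∑ ω, weight w ω * Ψ (ω ∩ A) = ∑ ω, weight (fun e => if e ∈ A then w e else 0) ω * Ψ ω := by
  set wI : ι → unitInterval := fun e => ⟨w e, hw0 e, hw1 e⟩ with hwI
  have hw : (fun e => (wI e : ℝ)) = w := funext fun e => rfl
  have h1 := integral_prodBernoulli_eq_sum wI (fun ω => Ψ (ω ∩ A))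
  rw [hw] at h1
  rw [← h1]
  have hmeas : Measurable fun ω : Set ι => A ∩ ω := Measurable.of_discrete
  have h2 : ∫ ω, Ψ (ω ∩ A) ∂(prodBernoulli wI) =
      ∫ ω, Ψ ω ∂((prodBernoulli wI).map fun ω => A ∩ ω) := by
    rw [integral_map hmeas.aemeasurable (Measurable.of_discrete).aestronglyMeasurable]
    simp_rw [Set.inter_comm A]
  rw [h2, BondTri.prodBernoulli_map_inter wI A, integral_prodBernoulli_eq_sum]
  refine Finset.sum_congr rfl fun ω _ => ?_
  congr 1
  unfold weight
  refine Finset.prod_congr rfl fun e _ => ?_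
  by_cases he : e ∈ A <;> simp [he, hwI]

/-- Weights switched off outside `A` are nonnegative. [folklore] -/
theorem restrictWeight_nonneg {ι : Type*} {w : ι → ℝ} (hw0 : ∀ e, 0 ≤ w e) (A : Set ι) (e : ι) :
    0 ≤ (if e ∈ A then w e else 0) := by
  split_ifs
  · exact hw0 e
  · exact le_rfl

/-- Weights switched off outside `A` are at most one. [folklore] -/
theorem restrictWeight_le_one {ι : Type*} {w : ι → ℝ} (hw1 : ∀ e, w e ≤ 1) (A : Set ι) (e : ι) :
    (if e ∈ A then w e else 0) ≤ 1 := by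
  split_ifs
  · exact hw1 e
  · exact zero_le_one

/-- **Lemma U for the model restricted to `U`**: `E[F(C_s^U)] E[g₀^U] ≤ E[F(C_s^U) g₀^U]`, where
`g₀^U(ω) = g₀(ω ∩ edgesIn U)` (`lemmaU` for the weights switched off outside `edgesIn U`, by
marginalisation). [folklore] -/
theorem lemmaU_restrict (w : Sym2 V → ℝ) (hw0 : ∀ e, 0 ≤ w e) (hw1 : ∀ e, w e ≤ 1)
    (hm : ∑ ω, weight w ω = 1) (U : Finset V) (s o : V) (F : Set (Sym2 V) → ℝ) (hF : Monotone F)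
    (h : Set (Sym2 V) → ℝ) (h1 : ∀ C, h C ≤ 1) :
    (∑ ω, weight w ω * F (rC U s ω)) *
        (∑ ω, weight w ω *
          (if (openGraph (ω ∩ edgesIn U)).Reachable s o then (1 : ℝ) else h (rC U o ω))) ≤
      ∑ ω, weight w ω * (F (rC U s ω) *
          (if (openGraph (ω ∩ edgesIn U)).Reachable s o then (1 : ℝ) else h (rC U o ω))) := by
  set w' : Sym2 V → ℝ := fun e => if e ∈ edgesIn U then w e else 0 with hw'
  set g : Set (Sym2 V) → ℝ := fun ω =>
    if (openGraph ω).Reachable s o then (1 : ℝ) else h (openEdgeCluster ω o) with hg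
  have hgU : ∀ ω, (if (openGraph (ω ∩ edgesIn U)).Reachable s o then (1 : ℝ) else h (rC U o ω)) =
      g (ω ∩ edgesIn U) := fun ω => rfl
  simp_rw [hgU]
  have e1 : ∑ ω, weight w ω * F (rC U s ω) = ∑ ω, weight w' ω * F (openEdgeCluster ω s) :=
    sum_weight_inter w hw0 hw1 (edgesIn U) fun ω => F (openEdgeCluster ω s)
  have e2 : ∑ ω, weight w ω * g (ω ∩ edgesIn U) = ∑ ω, weight w' ω * g ω :=
    sum_weight_inter w hw0 hw1 (edgesIn U) g
  have e3 : ∑ ω, weight w ω * (F (rC U s ω) * g (ω ∩ edgesIn U)) =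
      ∑ ω, weight w' ω * (F (openEdgeCluster ω s) * g ω) :=
    sum_weight_inter w hw0 hw1 (edgesIn U) fun ω => F (openEdgeCluster ω s) * g ω
  have hm' : ∑ ω, weight w' ω = 1 := by
    have := sum_weight_inter w hw0 hw1 (edgesIn U) fun _ => (1 : ℝ)
    simp only [mul_one] at this
    rw [← this, hm]
  rw [e1, e2, e3]
  exact lemmaU w' (restrictWeight_nonneg hw0 _) (restrictWeight_le_one hw1 _) hm' s o F hF h h1

/-! ### The sandwich function inside `U`: bounds, monotonicity in `T`, and BHK's restriction -/

/-- `0 ≤ g^(T) ≤ 1` inside `U`, lower bound (for `0 ≤ h`). [folklore] -/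
theorem sand_nonneg (U : Finset V) (s o : V) {h : Set (Sym2 V) → ℝ} (h0 : ∀ C, 0 ≤ h C)
    (T : Set V) (ω : Set (Sym2 V)) :
    0 ≤ (if (openGraph (ω ∩ edgesIn U)).Reachable s o then (1 : ℝ)
      else h (rC U o ω) * ind (rD U o T) ω) := by
  split_ifs
  · exact zero_le_one
  · exact mul_nonneg (h0 _) (ind_nonneg _ _)

/-- `0 ≤ g^(T) ≤ 1` inside `U`, upper bound (for `0 ≤ h ≤ 1`). [folklore] -/
theorem sand_le_one (U : Finset V) (s o : V) {h : Set (Sym2 V) → ℝ}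
    (h1 : ∀ C, h C ≤ 1) (T : Set V) (ω : Set (Sym2 V)) :
    (if (openGraph (ω ∩ edgesIn U)).Reachable s o then (1 : ℝ)
      else h (rC U o ω) * ind (rD U o T) ω) ≤ 1 := by
  split_ifs
  · exact le_rfl
  · exact mul_le_one₀ (h1 _) (ind_nonneg _ _) (ind_le_one _ _)

/-- `g^(T)` is antitone in the constraint set `T` (for `0 ≤ h`). [folklore] -/
theorem sand_antitone (U : Finset V) (s o : V) {h : Set (Sym2 V) → ℝ} (h0 : ∀ C, 0 ≤ h C)
    {T T' : Set V} (hTT' : T ⊆ T') (ω : Set (Sym2 V)) :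
    (if (openGraph (ω ∩ edgesIn U)).Reachable s o then (1 : ℝ)
      else h (rC U o ω) * ind (rD U o T') ω) ≤
    (if (openGraph (ω ∩ edgesIn U)).Reachable s o then (1 : ℝ)
      else h (rC U o ω) * ind (rD U o T) ω) := by
  split_ifs
  · exact le_rfl
  · exact mul_le_mul_of_nonneg_left (ind_mono (rD_antitone hTT') ω) (h0 _)

/-- With the empty constraint set `g^(∅) = g₀` inside `U`. [folklore] -/
theorem sand_empty (U : Finset V) (s o : V) (h : Set (Sym2 V) → ℝ) (ω : Set (Sym2 V)) :
    (if (openGraph (ω ∩ edgesIn U)).Reachable s o then (1 : ℝ)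
      else h (rC U o ω) * ind (rD U o (∅ : Set V)) ω) =
    (if (openGraph (ω ∩ edgesIn U)).Reachable s o then (1 : ℝ) else h (rC U o ω)) := by
  have : ω ∈ rD U o (∅ : Set V) := fun x hx => absurd hx (Set.notMem_empty x)
  rw [ind_of_mem this, mul_one]

/-- The sandwich function of `G[U ∖ Z]` does not depend on the pairs meeting `Z`. [folklore] -/
theorem sand_diff_meeting (U Z : Finset V) (s o : V) (h : Set (Sym2 V) → ℝ) (T : Set V)
    (η : Set (Sym2 V)) :
    (if (openGraph ((η \ meeting Z) ∩ edgesIn (U \ Z))).Reachable s o then (1 : ℝ)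
      else h (rC (U \ Z) o (η \ meeting Z)) * ind (rD (U \ Z) o T) (η \ meeting Z)) =
    (if (openGraph (η ∩ edgesIn (U \ Z))).Reachable s o then (1 : ℝ)
      else h (rC (U \ Z) o η) * ind (rD (U \ Z) o T) η) := by
  have hind : ind (rD (U \ Z) o T) (η \ meeting Z) = ind (rD (U \ Z) o T) η := by
    by_cases hη : η ∈ rD (U \ Z) o T
    · rw [ind_of_mem hη, ind_of_mem ((mem_rD_diff_meeting U Z o T η).2 hη)]
    · rw [ind_of_not_mem hη, ind_of_not_mem (fun h' => hη ((mem_rD_diff_meeting U Z o T η).1 h'))]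
  rw [diff_meeting_inter_edgesIn, rC_diff_meeting, hind]

omit [Fintype V] in
/-- Under BHK's restriction hypothesis for `s` (no vertex of `S(ω)` is joined to `s` in
`G[U ∖ Z]`), reachability from `s` inside `U` is reachability inside `U ∖ Z`.
[cite: VandenbergHaggstromKahn2005, §1 p. 4, identity (6)] -/
theorem reachable_restrict_iff {U Z : Finset V} {s : V} (hs : s ∉ Z) {ω : Set (Sym2 V)}
    (hS : ∀ n ∈ rS U Z ω, ¬ (openGraph (ω ∩ edgesIn (U \ Z))).Reachable s n) (v : V) :
    (openGraph (ω ∩ edgesIn U)).Reachable s v ↔ (openGraph (ω ∩ edgesIn (U \ Z))).Reachable s v :=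
  ⟨fun hv => (reach_restrict hs hS hv).2, fun hv => hv.mono (openGraph_le
    (Set.inter_subset_inter_right _ (edgesIn_mono Finset.sdiff_subset)))⟩

/-- **BHK's restriction for the sandwich function**: for `W ⊇ Z` with `s, o ∉ Z`, on the event
that no vertex of `S(ω)` is joined to `s` in `G[U ∖ Z]`,
`g^(W)` of `G[U]` equals `g^((W ∖ Z) ∪ S(ω))` of `G[U ∖ Z]` (identity (6) of BHK for the
observer's cluster: `o ↮ W in G[U]` iff `o ↮ (W ∖ Z) ∪ S in G[U ∖ Z]`, and then `C_o^U = C_o^{U∖Z}`).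
[cite: VandenbergHaggstromKahn2005, §1 p. 4, identity (6)] -/
theorem sand_restrict {U Z : Finset V} (hZU : Z ⊆ U) {s o : V} (hs : s ∉ Z) (ho : o ∉ Z)
    (h : Set (Sym2 V) → ℝ) {W : Set V} (hZW : (↑Z : Set V) ⊆ W) {ω : Set (Sym2 V)}
    (hS : ∀ n ∈ rS U Z ω, ¬ (openGraph (ω ∩ edgesIn (U \ Z))).Reachable s n) :
    (if (openGraph (ω ∩ edgesIn U)).Reachable s o then (1 : ℝ)
      else h (rC U o ω) * ind (rD U o W) ω) =
    (if (openGraph (ω ∩ edgesIn (U \ Z))).Reachable s o then (1 : ℝ)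
      else h (rC (U \ Z) o ω) * ind (rD (U \ Z) o ((W \ ↑Z) ∪ rS U Z ω)) ω) := by
  by_cases hr : (openGraph (ω ∩ edgesIn (U \ Z))).Reachable s o
  · rw [if_pos ((reachable_restrict_iff hs hS o).2 hr), if_pos hr]
  · rw [if_neg (fun h' => hr ((reachable_restrict_iff hs hS o).1 h')), if_neg hr]
    by_cases hω : ω ∈ rD U o W
    · have hω' : ω ∈ rD (U \ Z) o ((W \ ↑Z) ∪ rS U Z ω) := (mem_rD_iff_restrict hZU ho hZW ω).1 hω
      have hSo : ∀ n ∈ rS U Z ω, ¬ (openGraph (ω ∩ edgesIn (U \ Z))).Reachable o n :=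
        fun n hn => hω' n (Or.inr hn)
      rw [ind_of_mem hω, ind_of_mem hω', rC_restrict ho hSo]
    · rw [ind_of_not_mem hω, ind_of_not_mem (fun h' => hω ((mem_rD_iff_restrict hZU ho hZW ω).2 h')),
        mul_zero, mul_zero]

omit [Fintype V] in
/-- The indicator of `R_T` of `G[U ∖ Z]` does not depend on the pairs meeting `Z`. [folklore] -/
theorem ind_rD_diff_meeting (U Z : Finset V) (v : V) (T : Set V) (η : Set (Sym2 V)) :
    ind (rD (U \ Z) v T) (η \ meeting Z) = ind (rD (U \ Z) v T) η := by
  by_cases hη : η ∈ rD (U \ Z) v T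
  · rw [ind_of_mem hη, ind_of_mem ((mem_rD_diff_meeting U Z v T η).2 hη)]
  · rw [ind_of_not_mem hη, ind_of_not_mem (fun h' => hη ((mem_rD_diff_meeting U Z v T η).1 h'))]

/-- **Generic form of BHK's identity (6), summed**: if an integrand `Ψ` is, configuration by
configuration, a function `Ψ'` of the set `S(ω)` of vertices joined to `Z` by an open edge and of
the configuration off the pairs meeting `Z`, then `E[Ψ] = E_ω[ E_η[Ψ'(S(ω), η)] ]` (block Fubini).
[cite: VandenbergHaggstromKahn2005, §1 p. 4, the display before (5) and identity (6)] -/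
theorem step_sum_gen {U Z : Finset V} (w : Sym2 V → ℝ) (hm : ∑ ω, weight w ω = 1)
    (Ψ : Set (Sym2 V) → ℝ) (Ψ' : Set V → Set (Sym2 V) → ℝ)
    (hΨ : ∀ ω, Ψ ω = Ψ' (rS U Z ω) (ω \ meeting Z))
    (hΨ' : ∀ T η, Ψ' T (η \ meeting Z) = Ψ' T η) :
    ∑ ω, weight w ω * Ψ ω = ∑ ω, weight w ω * ∑ η, weight w η * Ψ' (rS U Z ω) η := by
  set A := meeting Z with hA
  set Φ : Set (Sym2 V) → Set (Sym2 V) → ℝ := fun ζ η => Ψ' (rS U Z ζ) η with hΦ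
  have e1 : ∀ ω, Ψ ω = Φ (ω ∩ A) (ω \ A) := fun ω => by
    simp only [hΦ, hA, rS_inter_meeting]; exact hΨ ω
  have e2 : ∀ ω ω', Φ (ω ∩ A) (ω' \ A) = Ψ' (rS U Z ω) ω' := fun ω ω' => by
    simp only [hΦ, hA, rS_inter_meeting]; exact hΨ' _ _
  calc ∑ ω, weight w ω * Ψ ω
      = (∑ ω, weight w ω) * ∑ ω, weight w ω * Φ (ω ∩ A) (ω \ A) := by
        rw [hm, one_mul]; simp_rw [e1]
    _ = ∑ ω, weight w ω * ∑ ω', weight w ω' * Φ (ω ∩ A) (ω' \ A) := blockFubini w A Φ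
    _ = _ := by simp_rw [e2]

end SandwichK41

/-! ### Registered stub form (siege k41) -/

open scoped Classical in
open SandwichK41 in
/-- **Registered stub `stub_sandwichLemmaU_k41`** (= `SandwichK41.lemmaU` on `Fin n`): Lemma U,
the unconditional sandwich correlation `E[F(C_s)] · E[g₀] ≤ E[F(C_s) g₀]` for `F` increasing and
`g₀ = 1{s ↔ o} + 1{s ↮ o} h(C_o)`, `h ≤ 1`. [folklore; cite: VandenbergHaggstromKahn2005, §1 p. 8 (coupling)] -/
theorem stub_sandwichLemmaU_k41 : ∀ (n : ℕ) (w : Sym2 (Fin n) → ℝ), (∀ e, 0 ≤ w e) → (∀ e, w e ≤ 1) → ∑ ω, BHK2006.weight w ω = 1 → ∀ (s o : Fin n) (F : Set (Sym2 (Fin n)) → ℝ), Monotone F → ∀ (h : Set (Sym2 (Fin n)) → ℝ), (∀ C, h C ≤ 1) → (∑ ω, BHK2006.weight w ω * F (openEdgeCluster ω s)) * (∑ ω, BHK2006.weight w ω * (if (openGraph ω).Reachable s o then (1 : ℝ) else h (openEdgeCluster ω o))) ≤ ∑ ω, BHK2006.weight w ω * (F (openEdgeCluster ω s) * (if (openGraph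 ω).Reachable s o then (1 : ℝ) else h (openEdgeCluster ω o))) :=
  fun _ w hw0 hw1 hm s o F hF h h1 => by convert lemmaU w hw0 hw1 hm s o F hF h h1 using 8

end Summit.CriticalPhenomena.PercolationContinuityZ3.Theorems
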